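import Summits.ABC.ABC.Theses.IsogenyGlueCongruence
import Literature.NumberTheory.EllipticCurves.DegreeConjectureAbcMurtyProofs
import Literature.NumberTheory.EllipticCurves.PeterssonNormLowerBoundSqrtProofs
import Literature.NumberTheory.EllipticCurves.SilvermanHeightCovolumeProofs
import Literature.NumberTheory.EllipticCurves.SzpiroOfAbcProofs
import Literature.NumberTheory.EllipticCurves.DegreeConjectureAbcPrelims
import Literature.NumberTheory.DiophantineGeometry.LocalReductionProofs
import Literature.NumberTheory.DiophantineGeometry.MinimalDiscriminantNormProofs
import Literature.Barriers.ABC.SzpiroEpsilonCannotBeDroppedHolds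

/-!
# `SharpDegreeOfPolyDegree` (stmt-ABC-10895): the exponent floor — the `2` in `N^{2+ε}` cannot be lowered

Negative support lemmas for the crux `R := Summit.ABC.ABC.Theses.IsogenyGlueCongruence.SharpDegreeOfPolyDegree`
(`PolyDegreeBound → SemistableDegreeConjecture`: "deg φ ≤ C N^κ for all semistable `E/ℚ` ⟹
deg φ ≤ C(ε) N^{2+ε}"), from the cdisprove seat (2026-08-16). No definitions; every statement is in
the expanded form of the route file. Companion: `Negative/LogicalPosition.lean`.

* `abs_disc_le_core`, `abs_disc_le_of_degreeBound` — a degree bound `deg φ ≤ C N^κ` together with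
  `(f,f) ≫ N^{1−η}`, `0 < κ − 1 + η < 1`, forces `|Δ_min| ≤ A N^6` on all semistable curves
  (Zagier's formula, Silverman's covolume inequality, `c ∈ ℤ∖{0}` — all tree theorems).
* `exists_globallyMinimal_model`, `exists_semistable_globallyMinimal` — transport to a global
  minimal model; the binder class of `X`/`R` is inhabited with unbounded conductor (non-vacuity).
* `not_degreeBound_of_petersson`, **`not_degreeBound_of_lt_three_halves` (UNCONDITIONAL)**,
  `not_degreeBound_of_lt_two` (modulo the route item `PeterssonLowerBound`) — the antecedent of `R`
  cannot hold with exponent `κ < 3/2` (resp. `κ < 2`): Masser's semistable Szpiro-excess curves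
  (`Literature.Barriers.ABC.Masser.exists_semistable_curve_polylog_excess`, proved).
* `exists_curve_forall_datum_gt_of_lt_three_halves` / `_of_lt_two` — positive form: for every `C`
  some semistable curve has ALL its data of degree `> C N^κ` (`κ < 3/2` unconditionally, `κ < 2` mod P).
* `not_targetWithExponent_of_lt_three_halves` / `_of_lt_two` — the natural strengthening of the
  target `X` (= `R`'s consequent) with `2` replaced by `θ < 3/2` (resp. `θ < 2`) is FALSE: the
  exponent `2` of the modular-degree conjecture is optimal. Consequently the only "free" instance of
  `R` (antecedent exponent `κ ≤ 2 ⟹ X` by monotonicity) is `κ ∈ [3/2, 2]` unconditionally and the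
  single point `κ = 2` modulo `PeterssonLowerBound`; every other instance is a genuine exponent drop.
* `strengthenedCrux_iff_not_degreeBound_of_lt_three_halves` / `_of_lt_two` — the correspondingly
  strengthened crux holds iff its own antecedent (the polynomial modular-degree conjecture) FAILS.
-/

noncomputable section

namespace Summit.ABC.ABC.Theorems.SharpDegreeOfPolyDegree.Negative

open Summit.ABC.ABC.Theses.IsogenyGlueCongruence
open Literature.NumberTheory.EllipticCurves Literature.NumberTheory.EllipticCurves.ModularForms
open WeierstrassCurve CongruenceSubgroup

/-- Monotonicity of the degree bound in the exponent (`N_E ≥ 1`). [folklore] -/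
theorem degreeBound_mono {κ κ' : ℝ} (h : κ ≤ κ')
    (hκ : ∃ C : ℝ, ∀ (W : WeierstrassCurve ℚ) [W.IsElliptic] [W.IsGloballyMinimal]
      [NeZero (W.conductorNorm ℤ)], W.IsSemistable ℤ →
        ∃ D : ModularParametrizationData W (W.conductorNorm ℤ),
          (D.modularDegree : ℝ) ≤ C * (W.conductorNorm ℤ : ℝ) ^ κ) :
    ∃ C : ℝ, ∀ (W : WeierstrassCurve ℚ) [W.IsElliptic] [W.IsGloballyMinimal]
      [NeZero (W.conductorNorm ℤ)], W.IsSemistable ℤ →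
        ∃ D : ModularParametrizationData W (W.conductorNorm ℤ),
          (D.modularDegree : ℝ) ≤ C * (W.conductorNorm ℤ : ℝ) ^ κ' := by
  obtain ⟨C, hC⟩ := hκ
  refine ⟨max C 0, fun W _ _ _ hss => ?_⟩
  obtain ⟨D, hD⟩ := hC W hss
  refine ⟨D, hD.trans ?_⟩
  have hN0 : (0 : ℝ) ≤ (W.conductorNorm ℤ : ℝ) := Nat.cast_nonneg _
  have hN : (1 : ℝ) ≤ (W.conductorNorm ℤ : ℝ) := by
    exact_mod_cast NeZero.pos (W.conductorNorm ℤ)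
  calc C * (W.conductorNorm ℤ : ℝ) ^ κ ≤ max C 0 * (W.conductorNorm ℤ : ℝ) ^ κ :=
        mul_le_mul_of_nonneg_right (le_max_left _ _) (Real.rpow_nonneg hN0 _)
    _ ≤ max C 0 * (W.conductorNorm ℤ : ℝ) ^ κ' :=
        mul_le_mul_of_nonneg_left (Real.rpow_le_rpow_of_exponent_le hN h) (le_max_right _ _)

/-! ## From a degree bound to a Szpiro bound with exponent `6` -/

/-- **Per-curve core of the exponent floor** (all constants explicit). For a parametrisation datum
`D` of `W` (global minimal form) at level `N` with `deg ≤ C N^κ`: Zagier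
(`4π² c² (f,f) = deg · covol(Λ_W)`, proved), `c ∈ ℤ ∖ {0}` (proved), `(f,f) ≥ c₂ N^{1−η}` give
`covol(Λ_W) ≥ K N^{−e}`, `e = κ − 1 + η`; Silverman's `|Δ_W| ≤ A covol^{−(6+ε_S)}` with
`e (6 + ε_S) = 6` then gives `|Δ_W| ≤ max(A,0) K^{−(6+ε_S)} N^6`.
[cite: MurtyCongruencePrimes1999, §2] -/
theorem abs_disc_le_core {κ η e εS c₂ C C₁ K A : ℝ}
    (he : e = κ - 1 + η) (hprod : (-e) * (-(6 + εS)) = 6) (hεS : 0 < εS)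
    (hC₁ : C ≤ C₁) (hC₁0 : 0 < C₁) (hK : K = 4 * Real.pi ^ 2 * c₂ / C₁) (hK0 : 0 < K)
    (hPc : ∀ (N : ℕ) [NeZero N] (W : WeierstrassCurve ℚ) [W.IsElliptic]
      (D : ModularParametrizationData W N),
        c₂ * (N : ℝ) ^ (1 - η) ≤ (peterssonProduct (Gamma0 N) 2 D.f D.f).re)
    (hA : ∀ (W : WeierstrassCurve ℚ) [W.IsElliptic] [W.IsGloballyMinimal]
      (L : PeriodPair), IsNeronLatticeOf (W.baseChange ℂ) L →
        ((max |W.Δ| (|W.c₄| ^ 3) : ℚ) : ℝ) ≤ A * ZLattice.covolume L.lattice ^ (-(6 + εS)))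
    (W : WeierstrassCurve ℚ) [W.IsElliptic] [W.IsGloballyMinimal] {N : ℕ} [NeZero N]
    (D : ModularParametrizationData W N)
    (hD : (D.modularDegree : ℝ) ≤ C * (N : ℝ) ^ κ) :
    ((|W.Δ| : ℚ) : ℝ) ≤ max A 0 * K ^ (-(6 + εS)) * (N : ℝ) ^ (6 : ℕ) := by
  have hN0 : (0 : ℝ) < N := by exact_mod_cast Nat.pos_of_ne_zero (NeZero.ne N)
  -- Zagier's identity, real form
  have hZ := congrArg Complex.re D.zagier_degree_formula_holds
  rw [Complex.re_ofReal_mul, Complex.ofReal_re] at hZ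
  have hc0 : D.maninConstant ≠ 0 := D.maninConstant_ne_zero_holds
  have hc : (D.c : ℝ) ≠ 0 := by exact_mod_cast hc0
  have hcov : 0 < ZLattice.covolume D.L.lattice := ZLattice.covolume_pos _ _
  -- `c² ≥ 1`
  have hc2 : (1 : ℝ) ≤ (D.c : ℝ) ^ 2 := by
    have h1 : (1 : ℤ) ≤ |D.c| := Int.one_le_abs hc0
    have h2 : (1 : ℝ) ≤ |(D.c : ℝ)| := by exact_mod_cast h1
    calc (1 : ℝ) = 1 ^ 2 := by norm_num
      _ ≤ |(D.c : ℝ)| ^ 2 := pow_le_pow_left₀ zero_le_one h2 2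
      _ = (D.c : ℝ) ^ 2 := sq_abs _
  -- the degree bound in the shape of `covolume_ge_of_zagier_exp`
  have hdeg : (D.deg : ℝ) ≤ C₁ * (D.c : ℝ) ^ 2 * (N : ℝ) ^ (2 + (κ - 2)) := by
    have h2 : (2 : ℝ) + (κ - 2) = κ := by ring
    rw [h2]
    have hNκ : (0 : ℝ) ≤ (N : ℝ) ^ κ := Real.rpow_nonneg hN0.le _
    calc (D.deg : ℝ) = (D.modularDegree : ℝ) := rfl
      _ ≤ C * (N : ℝ) ^ κ := hD
      _ ≤ C₁ * (N : ℝ) ^ κ := mul_le_mul_of_nonneg_right hC₁ hNκ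
      _ = C₁ * 1 * (N : ℝ) ^ κ := by ring
      _ ≤ C₁ * (D.c : ℝ) ^ 2 * (N : ℝ) ^ κ := by gcongr
  have hPD := hPc N W D
  have hlow := covolume_ge_of_zagier_exp hN0 hC₁0 hc hcov hZ hdeg hPD
  have hexp : -(1 + (κ - 2) + η) = -e := by rw [he]; ring
  rw [hexp, ← hK] at hlow
  have hKN : 0 < K * (N : ℝ) ^ (-e) := mul_pos hK0 (Real.rpow_pos_of_pos hN0 _)
  -- Silverman on the Néron lattice of the global minimal model `W`
  have hS := hA W D.L D.isNeronLattice
  have h1 : ((|W.Δ| : ℚ) : ℝ) ≤ ((max |W.Δ| (|W.c₄| ^ 3) : ℚ) : ℝ) :=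
    Rat.cast_le.mpr (le_max_left _ _)
  have h3 : (K * (N : ℝ) ^ (-e)) ^ (-(6 + εS)) = K ^ (-(6 + εS)) * (N : ℝ) ^ (6 : ℕ) := by
    rw [Real.mul_rpow hK0.le (Real.rpow_nonneg hN0.le _), ← Real.rpow_mul hN0.le, hprod,
      show (6 : ℝ) = ((6 : ℕ) : ℝ) by norm_num, Real.rpow_natCast]
  -- generic in the covolume (a direct `calc` through `covol(Λ_W)` is too slow to elaborate)
  have h2 : ∀ x : ℝ, K * (N : ℝ) ^ (-e) ≤ x →
      A * x ^ (-(6 + εS)) ≤ max A 0 * K ^ (-(6 + εS)) * (N : ℝ) ^ (6 : ℕ) := by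
    intro x hx
    have hx0 : 0 < x := hKN.trans_le hx
    calc A * x ^ (-(6 + εS)) ≤ max A 0 * x ^ (-(6 + εS)) :=
          mul_le_mul_of_nonneg_right (le_max_left _ _) (Real.rpow_nonneg hx0.le _)
      _ ≤ max A 0 * (K * (N : ℝ) ^ (-e)) ^ (-(6 + εS)) := by
          apply mul_le_mul_of_nonneg_left _ (le_max_right _ _)
          exact Real.rpow_le_rpow_of_nonpos hKN hx (by linarith)
      _ = max A 0 * K ^ (-(6 + εS)) * (N : ℝ) ^ (6 : ℕ) := by rw [h3]; ring
  exact h1.trans (hS.trans (h2 _ hlow))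

/-- **A degree bound with exponent `κ` forces `|Δ_min| ≤ A N^6` when `0 < κ − 1 + η < 1` and
`(f,f) ≫ N^{1−η}`** (for every semistable `W/ℚ` in global minimal form; `ε_S = 6(1−e)/e` in
`abs_disc_le_core`, Silverman's inequality from `silverman1986_discriminant_c4_covolume_holds`).
[cite: MurtyCongruencePrimes1999, §2] -/
theorem abs_disc_le_of_degreeBound {κ η : ℝ}
    (hP : ∃ c : ℝ, 0 < c ∧ ∀ (N : ℕ) [NeZero N] (W : WeierstrassCurve ℚ) [W.IsElliptic]
      (D : ModularParametrizationData W N),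
        c * (N : ℝ) ^ (1 - η) ≤ (peterssonProduct (Gamma0 N) 2 D.f D.f).re)
    (he0 : 0 < κ - 1 + η) (he1 : κ - 1 + η < 1)
    (hκ : ∃ C : ℝ, ∀ (W : WeierstrassCurve ℚ) [W.IsElliptic] [W.IsGloballyMinimal]
      [NeZero (W.conductorNorm ℤ)], W.IsSemistable ℤ →
        ∃ D : ModularParametrizationData W (W.conductorNorm ℤ),
          (D.modularDegree : ℝ) ≤ C * (W.conductorNorm ℤ : ℝ) ^ κ) :
    ∃ A : ℝ, ∀ (W : WeierstrassCurve ℚ) [W.IsElliptic] [W.IsGloballyMinimal],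
      W.IsSemistable ℤ → ((|W.Δ| : ℚ) : ℝ) ≤ A * (W.conductorNorm ℤ : ℝ) ^ (6 : ℕ) := by
  obtain ⟨c₂, _, hPc⟩ := hP
  obtain ⟨C, hC⟩ := hκ
  obtain ⟨e, he⟩ : ∃ e : ℝ, e = κ - 1 + η := ⟨_, rfl⟩
  have he0' : 0 < e := by rw [he]; exact he0
  have he1' : e < 1 := by rw [he]; exact he1
  obtain ⟨εS, hεS⟩ : ∃ εS : ℝ, εS = 6 * (1 - e) / e := ⟨_, rfl⟩
  have hεS0 : 0 < εS := by rw [hεS]; exact div_pos (by linarith) he0'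
  have hprod : (-e) * (-(6 + εS)) = 6 := by
    rw [hεS]; field_simp; ring
  obtain ⟨A, hA⟩ := silverman1986_discriminant_c4_covolume_holds εS hεS0
  have hC₁0 : 0 < max C 1 := lt_of_lt_of_le one_pos (le_max_right _ _)
  obtain ⟨K, hK⟩ : ∃ K : ℝ, K = 4 * Real.pi ^ 2 * c₂ / max C 1 := ⟨_, rfl⟩
  have hK0 : 0 < K := by rw [hK]; positivity
  refine ⟨max A 0 * K ^ (-(6 + εS)), fun W _ _ hss => ?_⟩
  have hNpos : 0 < W.conductorNorm ℤ := conductorNorm_pos_holds W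
  haveI : NeZero (W.conductorNorm ℤ) := ⟨hNpos.ne'⟩
  obtain ⟨D, hD⟩ := hC W hss
  exact abs_disc_le_core he hprod hεS0 (le_max_left C 1) hC₁0 hK hK0 hPc hA W D hD

/-! ## Transport to global minimal models; non-vacuity -/

/-- **Transport to a global minimal model** (Silverman AEC VIII.8.3 over the PID `ℤ`; conductor,
minimal discriminant and semistability are isomorphism invariants — all tree theorems): every
elliptic `W/ℚ` has a globally minimal model `W₁` with the same conductor, `|Δ_{W₁}| = |Δ_min(W)|`,
semistable if `W` is. [cite: SilvermanAEC2009, VIII.8 Cor. 8.3] -/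
theorem exists_globallyMinimal_model (W : WeierstrassCurve ℚ) [W.IsElliptic] :
    ∃ W₁ : WeierstrassCurve ℚ, W₁.IsElliptic ∧ W₁.IsGloballyMinimal ∧
      (W.IsSemistable ℤ → W₁.IsSemistable ℤ) ∧ W₁.conductorNorm ℤ = W.conductorNorm ℤ ∧
      ((|W₁.Δ| : ℚ) : ℝ) = (W.minimalDiscriminantNorm ℤ : ℝ) := by
  obtain ⟨Cv, W₀, hCW, hmin⟩ := W.exists_baseChange_int_forall_isMinimalAt
  have hΔ0 : W₀.Δ ≠ 0 := by
    intro h0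
    have h1 : (Cv • W).Δ = 0 := by
      simp [hCW, WeierstrassCurve.baseChange, WeierstrassCurve.map_Δ, h0]
    exact (Cv • W).isUnit_Δ.ne_zero h1
  haveI hE₁ : (W₀.baseChange ℚ).IsElliptic := isElliptic_baseChange_int W₀ hΔ0
  haveI hM₁ : (W₀.baseChange ℚ).IsGloballyMinimal :=
    isGloballyMinimal_of_forall_isMinimalAt_int _ hmin
  refine ⟨W₀.baseChange ℚ, hE₁, hM₁, fun hss => ?_, ?_, ?_⟩
  · rw [← hCW]
    exact (isSemistable_smul_iff_holds ℤ W Cv).mpr hss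
  · rw [← hCW, conductorNorm_smul_rat]
  · have hD₁ : W.minimalDiscriminantNorm ℤ = W₀.Δ.natAbs := by
      rw [← minimalDiscriminantNorm_smul_rat W Cv, hCW,
        minimalDiscriminantNorm_eq_natAbs_holds W₀ hΔ0 hmin]
    have hΔ : (W₀.baseChange ℚ).Δ = (W₀.Δ : ℚ) := by
      simp [WeierstrassCurve.baseChange, WeierstrassCurve.map_Δ]
    rw [hD₁, hΔ, Nat.cast_natAbs]
    push_cast
    rfl

/-- **Non-vacuity of the binder class of `X` and `R`.** Semistable elliptic curves over `ℚ` in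
global minimal form exist with arbitrarily large conductor (Masser's Frey curves, transported):
neither side of `R` is vacuous, and no finite computation bears on it. [cite: Masser1990, Lemma 1] -/
theorem exists_semistable_globallyMinimal (N₀ : ℕ) :
    ∃ W : WeierstrassCurve ℚ, W.IsElliptic ∧ W.IsGloballyMinimal ∧ W.IsSemistable ℤ ∧
      N₀ < W.conductorNorm ℤ := by
  obtain ⟨W, hW, hss, hN, -⟩ :=
    Literature.Barriers.ABC.Masser.exists_semistable_curve_polylog_excess 0 0 N₀
  haveI := hW
  obtain ⟨W₁, hE₁, hM₁, hss₁, hN₁, -⟩ := exists_globallyMinimal_model W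
  exact ⟨W₁, hE₁, hM₁, hss₁ hss, by rwa [hN₁]⟩

/-! ## The exponent floor -/

/-- **The exponent floor, master form.** If `(f,f) ≥ c N^{1−η}` for the newforms of parametrisation
data of elliptic curves and `κ + η < 2`, then `deg φ ≤ C N^κ` fails for some semistable curve in
global minimal form: otherwise (after raising `κ` into the window `1 − η < κ' < 2 − η`)
`abs_disc_le_of_degreeBound` gives `|Δ_min| ≤ A N^6` on ALL semistable curves via a global minimal
model, contradicting Masser's semistable curves with `|Δ_min| > A N^6`
(`Masser.exists_semistable_curve_polylog_excess`). [cite: Masser1990, Theorem and Lemma 1] -/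
theorem not_degreeBound_of_petersson {κ η : ℝ}
    (hP : ∃ c : ℝ, 0 < c ∧ ∀ (N : ℕ) [NeZero N] (W : WeierstrassCurve ℚ) [W.IsElliptic]
      (D : ModularParametrizationData W N),
        c * (N : ℝ) ^ (1 - η) ≤ (peterssonProduct (Gamma0 N) 2 D.f D.f).re)
    (hκη : κ + η < 2) :
    ¬ ∃ C : ℝ, ∀ (W : WeierstrassCurve ℚ) [W.IsElliptic] [W.IsGloballyMinimal]
      [NeZero (W.conductorNorm ℤ)], W.IsSemistable ℤ →
        ∃ D : ModularParametrizationData W (W.conductorNorm ℤ),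
          (D.modularDegree : ℝ) ≤ C * (W.conductorNorm ℤ : ℝ) ^ κ := by
  intro hκ
  -- raise `κ` into the window `1 − η < κ' < 2 − η`
  have he0 : 0 < max κ (3 / 2 - η) - 1 + η := by
    have := le_max_right κ (3 / 2 - η)
    linarith
  have he1 : max κ (3 / 2 - η) - 1 + η < 1 := by
    rcases le_total κ (3 / 2 - η) with h | h
    · rw [max_eq_right h]; linarith
    · rw [max_eq_left h]; linarith
  obtain ⟨A, hA⟩ := abs_disc_le_of_degreeBound hP he0 he1 (degreeBound_mono (le_max_left _ _) hκ)
  -- Masser's semistable curve with `|Δ_min| > A N^6`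
  obtain ⟨W, hW, hss, -, hlt⟩ :=
    Literature.Barriers.ABC.Masser.exists_semistable_curve_polylog_excess 0 A 0
  haveI := hW
  rw [Real.rpow_zero, mul_one] at hlt
  obtain ⟨W₁, hE₁, hM₁, hss₁, hN₁, hΔ₁⟩ := exists_globallyMinimal_model W
  have hbound := hA W₁ (hss₁ hss)
  rw [hΔ₁, hN₁] at hbound
  exact absurd hbound (not_le.mpr hlt)

/-- **Exponent floor `3/2`, UNCONDITIONAL.** No `C, κ` with `κ < 3/2` give `deg φ ≤ C N_E^κ` for a
parametrisation of every semistable `E/ℚ` (global minimal form, level `N_E`): the antecedent of `R`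
can only hold with `κ ≥ 3/2`. Inputs: Iwaniec's elementary `(f,f) ≫ N^{1/2−δ}` (tree theorem
`HoffsteinLockhart1994_peterssonProduct_lower_bound_of_half_lt`), Zagier, Silverman, Masser — all
proved. [cite: Iwaniec2002, Thm. 8.3] -/
theorem not_degreeBound_of_lt_three_halves {κ : ℝ} (hκ : κ < 3 / 2) :
    ¬ ∃ C : ℝ, ∀ (W : WeierstrassCurve ℚ) [W.IsElliptic] [W.IsGloballyMinimal]
      [NeZero (W.conductorNorm ℤ)], W.IsSemistable ℤ →
        ∃ D : ModularParametrizationData W (W.conductorNorm ℤ),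
          (D.modularDegree : ℝ) ≤ C * (W.conductorNorm ℤ : ℝ) ^ κ :=
  not_degreeBound_of_petersson
    (HoffsteinLockhart1994_peterssonProduct_lower_bound_of_half_lt (ε := 5 / 4 - κ / 2)
      (by linarith)) (by linarith)

/-- **Exponent floor `2`, modulo the route item `PeterssonLowerBound`** (`(f,f) ≫_ε N^{1−ε}`,
Hoffstein–Lockhart 1994): no `C, κ` with `κ < 2` give `deg φ ≤ C N_E^κ` over all semistable
`E/ℚ`. So the free instance of `R` (antecedent exponent `κ ≤ 2 ⟹ X` by monotonicity) is the single
point `κ = 2`, and everything else in `R` is a genuine exponent drop `κ ↦ 2 + ε`.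
[cite: HoffsteinLockhart1994, Thm. 0.1] -/
theorem not_degreeBound_of_lt_two (hP : PeterssonLowerBound) {κ : ℝ} (hκ : κ < 2) :
    ¬ ∃ C : ℝ, ∀ (W : WeierstrassCurve ℚ) [W.IsElliptic] [W.IsGloballyMinimal]
      [NeZero (W.conductorNorm ℤ)], W.IsSemistable ℤ →
        ∃ D : ModularParametrizationData W (W.conductorNorm ℤ),
          (D.modularDegree : ℝ) ≤ C * (W.conductorNorm ℤ : ℝ) ^ κ := by
  obtain ⟨c, hc, h⟩ := hP ((2 - κ) / 2) (by linarith)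
  exact not_degreeBound_of_petersson (η := (2 - κ) / 2)
    ⟨c, hc, fun N _ W _ D => h N W D.f D.isNewformOf⟩ (by linarith)

/-- Positive form of a failed degree bound: for every `C` some semistable curve in global minimal
form has ALL its parametrisation data at level `N_E` of degree `> C · N_E^κ`. [folklore] -/
theorem exists_curve_forall_datum_gt_of_not_degreeBound {κ : ℝ}
    (h : ¬ ∃ C : ℝ, ∀ (W : WeierstrassCurve ℚ) [W.IsElliptic] [W.IsGloballyMinimal]
      [NeZero (W.conductorNorm ℤ)], W.IsSemistable ℤ →
        ∃ D : ModularParametrizationData W (W.conductorNorm ℤ),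
          (D.modularDegree : ℝ) ≤ C * (W.conductorNorm ℤ : ℝ) ^ κ) (C : ℝ) :
    ∃ (W : WeierstrassCurve ℚ) (_ : W.IsElliptic) (_ : W.IsGloballyMinimal)
      (_ : NeZero (W.conductorNorm ℤ)), W.IsSemistable ℤ ∧
        ∀ D : ModularParametrizationData W (W.conductorNorm ℤ),
          C * (W.conductorNorm ℤ : ℝ) ^ κ < (D.modularDegree : ℝ) := by
  by_contra hcon
  push Not at hcon
  exact h ⟨C, fun W hE hM hN hss => hcon W hE hM hN hss⟩

/-- **Large modular degrees, unconditionally.** For every `C` and every `κ < 3/2` there is a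
semistable `E/ℚ` in global minimal form all of whose modular parametrisation data at level `N_E`
have degree `> C · N_E^κ` — the Lean form of "`deg φ_min ≥ N^{3/2−δ}` infinitely often along
Masser's family". [cite: Masser1990, Theorem] -/
theorem exists_curve_forall_datum_gt_of_lt_three_halves {κ : ℝ} (hκ : κ < 3 / 2) (C : ℝ) :
    ∃ (W : WeierstrassCurve ℚ) (_ : W.IsElliptic) (_ : W.IsGloballyMinimal)
      (_ : NeZero (W.conductorNorm ℤ)), W.IsSemistable ℤ ∧
        ∀ D : ModularParametrizationData W (W.conductorNorm ℤ),
          C * (W.conductorNorm ℤ : ℝ) ^ κ < (D.modularDegree : ℝ) :=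
  exists_curve_forall_datum_gt_of_not_degreeBound (not_degreeBound_of_lt_three_halves hκ) C

/-- **Large modular degrees modulo `PeterssonLowerBound`**: the same for every `κ < 2`
(`deg φ_min ≥ N^{2−δ}` infinitely often). [cite: HoffsteinLockhart1994, Thm. 0.1] -/
theorem exists_curve_forall_datum_gt_of_lt_two (hP : PeterssonLowerBound) {κ : ℝ} (hκ : κ < 2)
    (C : ℝ) :
    ∃ (W : WeierstrassCurve ℚ) (_ : W.IsElliptic) (_ : W.IsGloballyMinimal)
      (_ : NeZero (W.conductorNorm ℤ)), W.IsSemistable ℤ ∧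
        ∀ D : ModularParametrizationData W (W.conductorNorm ℤ),
          C * (W.conductorNorm ℤ : ℝ) ^ κ < (D.modularDegree : ℝ) :=
  exists_curve_forall_datum_gt_of_not_degreeBound (not_degreeBound_of_lt_two hP hκ) C

/-- **Natural strengthening of the target refuted (unconditional):** the modular-degree conjecture
with `2` replaced by any `θ < 3/2` is FALSE. [cite: Masser1990, Theorem] -/
theorem not_targetWithExponent_of_lt_three_halves {θ : ℝ} (hθ : θ < 3 / 2) :
    ¬ ∀ ε : ℝ, 0 < ε → ∃ C : ℝ, ∀ (W : WeierstrassCurve ℚ) [W.IsElliptic] [W.IsGloballyMinimal]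
      [NeZero (W.conductorNorm ℤ)], W.IsSemistable ℤ →
        ∃ D : ModularParametrizationData W (W.conductorNorm ℤ),
          (D.modularDegree : ℝ) ≤ C * (W.conductorNorm ℤ : ℝ) ^ (θ + ε) := fun h =>
  not_degreeBound_of_lt_three_halves (κ := θ + (3 / 2 - θ) / 2) (by linarith) (h _ (by linarith))

/-- **Natural strengthening of the target refuted (mod `PeterssonLowerBound`):** the modular-degree
conjecture with `2` replaced by any `θ < 2` is FALSE — the `2` in `N^{2+ε}` is optimal.
[cite: HoffsteinLockhart1994, Thm. 0.1] -/
theorem not_targetWithExponent_of_lt_two (hP : PeterssonLowerBound) {θ : ℝ} (hθ : θ < 2) :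
    ¬ ∀ ε : ℝ, 0 < ε → ∃ C : ℝ, ∀ (W : WeierstrassCurve ℚ) [W.IsElliptic] [W.IsGloballyMinimal]
      [NeZero (W.conductorNorm ℤ)], W.IsSemistable ℤ →
        ∃ D : ModularParametrizationData W (W.conductorNorm ℤ),
          (D.modularDegree : ℝ) ≤ C * (W.conductorNorm ℤ : ℝ) ^ (θ + ε) := fun h =>
  not_degreeBound_of_lt_two hP (κ := θ + (2 - θ) / 2) (by linarith) (h _ (by linarith))

/-- **The strengthened crux is self-defeating (unconditional, `θ < 3/2`):** "`PolyDegreeBound ⟹`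
degree conjecture with exponent `θ`" holds iff `PolyDegreeBound` FAILS. [folklore] -/
theorem strengthenedCrux_iff_not_degreeBound_of_lt_three_halves {θ : ℝ} (hθ : θ < 3 / 2) :
    ((∃ κ C : ℝ, ∀ (W : WeierstrassCurve ℚ) [W.IsElliptic] [W.IsGloballyMinimal]
        [NeZero (W.conductorNorm ℤ)], W.IsSemistable ℤ →
          ∃ D : ModularParametrizationData W (W.conductorNorm ℤ),
            (D.modularDegree : ℝ) ≤ C * (W.conductorNorm ℤ : ℝ) ^ κ) →
      ∀ ε : ℝ, 0 < ε → ∃ C : ℝ, ∀ (W : WeierstrassCurve ℚ) [W.IsElliptic] [W.IsGloballyMinimal]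
        [NeZero (W.conductorNorm ℤ)], W.IsSemistable ℤ →
          ∃ D : ModularParametrizationData W (W.conductorNorm ℤ),
            (D.modularDegree : ℝ) ≤ C * (W.conductorNorm ℤ : ℝ) ^ (θ + ε)) ↔
    ¬ ∃ κ C : ℝ, ∀ (W : WeierstrassCurve ℚ) [W.IsElliptic] [W.IsGloballyMinimal]
        [NeZero (W.conductorNorm ℤ)], W.IsSemistable ℤ →
          ∃ D : ModularParametrizationData W (W.conductorNorm ℤ),
            (D.modularDegree : ℝ) ≤ C * (W.conductorNorm ℤ : ℝ) ^ κ :=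
  ⟨fun h hp => not_targetWithExponent_of_lt_three_halves hθ (h hp), fun h hp => absurd hp h⟩

/-- **… and modulo `PeterssonLowerBound` the same for every `θ < 2`.** [folklore] -/
theorem strengthenedCrux_iff_not_degreeBound_of_lt_two (hP : PeterssonLowerBound) {θ : ℝ}
    (hθ : θ < 2) :
    ((∃ κ C : ℝ, ∀ (W : WeierstrassCurve ℚ) [W.IsElliptic] [W.IsGloballyMinimal]
        [NeZero (W.conductorNorm ℤ)], W.IsSemistable ℤ →
          ∃ D : ModularParametrizationData W (W.conductorNorm ℤ),
            (D.modularDegree : ℝ) ≤ C * (W.conductorNorm ℤ : ℝ) ^ κ) →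
      ∀ ε : ℝ, 0 < ε → ∃ C : ℝ, ∀ (W : WeierstrassCurve ℚ) [W.IsElliptic] [W.IsGloballyMinimal]
        [NeZero (W.conductorNorm ℤ)], W.IsSemistable ℤ →
          ∃ D : ModularParametrizationData W (W.conductorNorm ℤ),
            (D.modularDegree : ℝ) ≤ C * (W.conductorNorm ℤ : ℝ) ^ (θ + ε)) ↔
    ¬ ∃ κ C : ℝ, ∀ (W : WeierstrassCurve ℚ) [W.IsElliptic] [W.IsGloballyMinimal]
        [NeZero (W.conductorNorm ℤ)], W.IsSemistable ℤ →
          ∃ D : ModularParametrizationData W (W.conductorNorm ℤ),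
            (D.modularDegree : ℝ) ≤ C * (W.conductorNorm ℤ : ℝ) ^ κ :=
  ⟨fun h hp => not_targetWithExponent_of_lt_two hP hθ (h hp), fun h hp => absurd hp h⟩

end Summit.ABC.ABC.Theorems.SharpDegreeOfPolyDegree.Negative
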